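import Summits.CriticalPhenomena.SAWScalingLimit.Theorems.SAWReversalUpgradePathUpgradeRRangeBoundAux
import Summits.CriticalPhenomena.SAWScalingLimit.Theorems.SAWReversalUpgradePathUpgradeRLawClosed
import Summits.CriticalPhenomena.SAWScalingLimit.Theorems.SAWReversalUpgradePathUpgradeRHullHausdorff
import Summits.CriticalPhenomena.SAWScalingLimit.Theorems.SAWReversalUpgradePathUpgradeRSLEHullPackage
import Summits.CriticalPhenomena.SAWScalingLimit.Theorems.SAWReversalUpgradePathUpgradeRLatticeDictionary
import Literature.Probability.RandomPlanarGeometry.SLERestrictionLocal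
import Literature.Probability.RandomPlanarGeometry.SLELawTransport
import Literature.Probability.RandomPlanarGeometry.RestrictionHullsHolds
import Literature.Probability.RandomPlanarGeometry.SLETransienceKappaEightHolds
import Literature.Probability.RandomPlanarGeometry.DrivingFunctionMeasurable
import Literature.Probability.RandomPlanarGeometry.SLETraceKappaLimit
import Literature.Probability.RandomPlanarGeometry.SLERestrictionMartingale
import Literature.Probability.RandomPlanarGeometry.LocalMartingaleProofs
import Literature.Probability.RandomPlanarGeometry.SeparatedTraces
import Literature.Probability.RandomPlanarGeometry.LoewnerDescription
import Mathlib.MeasureTheory.Constructions.BorelSpace.Metric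
import HarnessLib

/-!
# `stub_rangeBound` — RANGE as a closed-set bound (crux `PathUpgradeR`,
stmt-CriticalPhenomena-18055, route `SAWReversalUpgrade`, line `bidir_windows`)

Landing target:
`Summits/CriticalPhenomena/SAWScalingLimit/Theorems/SAWReversalUpgradePathUpgradeRRangeBound.lean`
(`--supports stmt-CriticalPhenomena-18055`; registered stub `stub_rangeBound` of
`Cruxes/PathUpgradeR/Lines/bidir_windows.lean`, statement verbatim).

**Theorem.** Assume the three neighbour statements of the line: `LawClosed` (closed-set
portmanteau along the mesh filter, as an equivalence with `TendstoLaw`), `SLEHullPackage` (a.e.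
`closure K_T(√κB) = γ[0,T]`, sup-norm continuity of `W ↦ φ̄ (closure K_T(W))` at `√κ B`, and the tip
`φ̄ (γ t) → b`) and `LatticeDictionary` (a simple described curve reads its hulls off its trace, and
capacity forces an approach of `b`). Then for random SIMPLE curves `X δ ω` from `a` to `b` in a
Dobrushin domain `(D; a, b)` with eventually-probability laws (H1), eventually a.e.-measurable
classes (H2), simplicity and endpoints (H3), forward driving functions converging in law on every
`[0, T]` to `√(8/3) B` (H4) and no escape from `b` (H7), there is an SLE_(8/3) curve `Γ` of `D` with
the closed-set bound for the RANGES in `NonemptyCompacts ℂ`: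
`∀ F closed, ∀ β > 0, ∀ᶠ δ, P δ {range X ∈ F} ≤ P' {range Γ ∈ F} + β`.

**Proof** (deterministic and measure-theoretic lemmas in the helper file
`SAWReversalUpgradePathUpgradeRRangeBoundAux.lean`, registered helper `stub_rangeBound_aux1`,
sub-namespace `PathUpgradeRRangeBound`). `Γ` is the SLE_(8/3) curve through `φ`
(`exists_isSLECurve_through_of_ae_tendsto`, `IsSLECurve.of_through`), so a.s.
`range Γ = φ̄ (range γ) ∪ {b}` with `γ` the trace. Fix `F`, `β` and `β' = β / 5`. Choose `ε` with `P' {range Γ ∈ F_{5ε}} ≤ P' {range Γ ∈ F} + β'`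
(`tendsto_measure_cthickening_of_isClosed`), `N₁` with `P' {∃ t ≥ N₁, |φ̄ (γ t) - b| > ε} ≤ β'`
(transience clause of `SLEHullPackage`, continuity from above along a countable dense set of
times), `r` from H7 with `(ε, η)`, `ENNReal.ofReal η ≤ β'`, the capacity threshold `T₀ (min r ε)`
of `LatticeDictionary`, and `T ≥ max N₁ T₀`, `T > 0`. Let
`A₀ = {W'|[0,T] : K_T(W') ≠ ∅, ∃ K ∈ F, d_H (φ̄ (closure K_T(W')), K) ≤ 2ε}` in `C([0,T], ℝ)`.
`LawClosed (→)` applied to H4 on `closure A₀` and on `{0}` gives eventually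
`P δ {W^δ|[0,T] ∈ closure A₀} ≤ P' {√κB|[0,T] ∈ closure A₀} + β'` and
`P δ {W^δ|[0,T] = 0} ≤ P' {√κ B_T = 0} + β' = β'` (Gaussian law, no atom). SLE side: for a.e. `ω`
with `√κB|[0,T] ∈ closure A₀`, sup-closeness of some `W' ∈ A₀` and the continuity clause give
`d_H (φ̄ γ[0,T], K) ≤ 3ε`, and off the tail event `d_H (range Γ, φ̄ γ[0,T]) ≤ 2ε`, so
`range Γ ∈ F_{5ε}`. Lattice side: if `range X ∈ F`, `X` is describable and the H7 window does not
occur, the dictionary gives `φ̄ (closure K_T(W^δ)) = X[0,u₀]` with a point of `X[0,u₀]`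
`(min r ε)`-close to `b`, hence `X[u₀,1] ⊆ B(b, ε)` and `d_H (X[0,u₀], range X) ≤ 2ε`, i.e.
`W^δ|[0,T] ∈ A₀`; non-describable classes have the junk driver `0`. Union bound:
`P δ {range X ∈ F} ≤ P' {range Γ ∈ F} + 5β'`. [folklore]
-/

noncomputable section

open scoped ENNReal NNReal Topology unitInterval
open MeasureTheory Filter Set Metric TopologicalSpace
open Literature.Probability Literature.Probability.RandomPlanarGeometry
open UpperHalfPlane (upperHalfPlaneSet)

namespace Summit.CriticalPhenomena.SAWScalingLimit.Theorems

namespace PathUpgradeRRangeBound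

open scoped PathBorel in
/-- **`RangeBound` with its three neighbour hypotheses** (`LawClosed → SLEHullPackage → LatticeDictionary →`
conclusion; the text of `def RangeBound` of `Cruxes/PathUpgradeR/Lines/bidir_windows.lean`): an SLE_(8/3)
curve `Γ` of `D` (the one through `φ`) with the closed-set bound for the ranges in `NonemptyCompacts ℂ`,
`∀ F closed, ∀ β > 0, ∀ᶠ δ, P δ {range X ∈ F} ≤ P' {range Γ ∈ F} + β`, from H1 H2 H3 H4 H7. See the module
docstring for the proof (`ε` from `tendsto_measure_cthickening_of_isClosed`, SLE tail by transience, lattice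
tail by H7 + capacity, the bad driver set `A₀` and `LawClosed (→)` on `closure A₀` and on `{0}`, the
atomless law of `B_T`, union bounds with budget `β / 5`). [folklore] -/
theorem rangeBound_of : (∀ (S : Type) [PseudoEMetricSpace S] [MeasurableSpace S] [BorelSpace S] (Ωδ : ℝ → Type) [∀ δ, MeasurableSpace (Ωδ δ)] (Ω' : Type) [MeasurableSpace Ω'] (Y : (δ : ℝ) → Ωδ δ → S) (P : (δ : ℝ) → MeasureTheory.Measure (Ωδ δ)) (Z : Ω' → S) (P' : MeasureTheory.Measure Ω'), MeasureTheory.IsProbabilityMeasure P' → (∀ᶠ δ in (nhdsWithin (0:ℝ) (Set.Ioi 0)), MeasureTheory.IsProbabilityMeasure (P δ)) → (∀ᶠ δ in (nhdsWithin (0:ℝ) (Set.Ioi 0)), AEMeasurable (Y δ) (P δ)) → AEMeasurable Z P' → (Literature.Probability.RandomPlanarGeometry.TendstoLaw Y P Z P' ↔ ∀ F : Set S, IsClosed F → ∀ β : ENNReal, 0 < β → ∀ᶠ δ in (nhdsWithin (0:ℝ) (Set.Ioi 0)), P δ (Y δ ⁻¹' F) ≤ P' (Z ⁻¹' F) + β))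 → (∀ (D : Literature.Probability.RandomPlanarGeometry.DobrushinDomain) (φ : Literature.Probability.RandomPlanarGeometry.ConformalEquiv UpperHalfPlane.upperHalfPlaneSet D.carrier), D.IsChordalUniformizing φ → (∀ T : NNReal, 0 < T → ∀ᵐ ω ∂Literature.Probability.Process.preWienerMeasure, closure (Literature.Probability.RandomPlanarGeometry.Loewner.hull (Literature.Probability.RandomPlanarGeometry.sleDriving ((8:NNReal)/3) ω) T) = Literature.Probability.RandomPlanarGeometry.sleTrace ((8:NNReal)/3) ω '' Set.Icc 0 T ∧ ∀ ε : ℝ, 0 < ε → ∃ ρ : ℝ, 0 < ρ ∧ ∀ W' : NNReal → ℝ, Continuous W' → (∀ s : NNReal, s ≤ T → |W' s - Literature.Probability.RandomPlanarGeometry.sleDriving ((8:NNReal)/3) ω s| ≤ ρ) → Metric.hausdorffDist (φ.boundaryExtension '' closure (Literature.Probability.RandomPlanarGeometry.Loewner.hull W' T)) (φ.boundaryExtension '' closure (Literature.Probability.RandomPlanarGeometry.Loewner.hull (Literature.Probability.RandomPlanarGeometry.sleDriving ((8:NNReal)/3) ω) T)) ≤ ε) ∧ (∀ᵐ ω ∂Literature.Probability.Process.preWienerMeasure,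 ∀ ε : ℝ, 0 < ε → ∃ T₀ : NNReal, ∀ t : NNReal, T₀ ≤ t → dist (φ.boundaryExtension (Literature.Probability.RandomPlanarGeometry.sleTrace ((8:NNReal)/3) ω t)) (D.pt 1) ≤ ε)) → (∀ (D : Literature.Probability.RandomPlanarGeometry.DobrushinDomain) (φ : Literature.Probability.RandomPlanarGeometry.ConformalEquiv UpperHalfPlane.upperHalfPlaneSet D.carrier), D.IsChordalUniformizing φ → (∀ (X : Literature.Probability.RandomPlanarGeometry.Curve ℂ) (W : NNReal → ℝ), Function.Injective X → X.source = D.pt 0 → X.target = D.pt 1 → (∀ t : unitInterval, X t = D.pt 0 ∨ X t = D.pt 1 ∨ X t ∈ D.carrier) → Literature.Probability.RandomPlanarGeometry.IsLoewnerDescribed φ (Literature.Probability.RandomPlanarGeometry.CurveClass.mk X) W → Literature.Probability.RandomPlanarGeometry.Loewner.IsSimpleTrace (Literature.Probability.RandomPlanarGeometry.Loewner.trace W) ∧ (∀ T : NNReal, 0 < T → closure (Literature.Probability.RandomPlanarGeometry.Loewner.hull W T) = Literature.Probability.RandomPlanarGeometry.Loewner.trace W '' Set.Icc 0 T) ∧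 (∀ T : NNReal, ∃ u₀ : unitInterval, X u₀ = φ.boundaryExtension (Literature.Probability.RandomPlanarGeometry.Loewner.trace W T) ∧ X '' Set.Icc 0 u₀ = φ.boundaryExtension '' (Literature.Probability.RandomPlanarGeometry.Loewner.trace W '' Set.Icc 0 T))) ∧ (∀ r : ℝ, 0 < r → ∃ T₀ : NNReal, ∀ (W : NNReal → ℝ) (γ : NNReal → ℂ), Continuous W → Literature.Probability.RandomPlanarGeometry.Loewner.IsGeneratedByCurve W γ → ∀ T : NNReal, T₀ ≤ T → ∃ t : NNReal, t ≤ T ∧ dist (φ.boundaryExtension (γ t)) (D.pt 1) < r)) → ∀ (D : Literature.Probability.RandomPlanarGeometry.DobrushinDomain) (φ : Literature.Probability.RandomPlanarGeometry.ConformalEquiv UpperHalfPlane.upperHalfPlaneSet D.carrier), D.IsChordalUniformizing φ → ∀ (Ω : ℝ → Type) [∀ δ, MeasurableSpace (Ω δ)] (X : (δ : ℝ) → Ω δ → Literature.Probability.RandomPlanarGeometry.Curve ℂ) (P : (δ : ℝ) → MeasureTheory.Measure (Ω δ)), (∀ᶠ δ in (nhdsWithin (0:ℝ) (Set.Ioi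 0)), MeasureTheory.IsProbabilityMeasure (P δ)) → (∀ᶠ δ in (nhdsWithin (0:ℝ) (Set.Ioi 0)), AEMeasurable (fun ω => Literature.Probability.RandomPlanarGeometry.CurveClass.mk (X δ ω)) (P δ)) → (∀ᶠ δ in (nhdsWithin (0:ℝ) (Set.Ioi 0)), ∀ ω : Ω δ, Function.Injective (X δ ω) ∧ (X δ ω).source = D.pt 0 ∧ (X δ ω).target = D.pt 1 ∧ ∀ t : unitInterval, X δ ω t = D.pt 0 ∨ X δ ω t = D.pt 1 ∨ X δ ω t ∈ D.carrier) → (∀ T : NNReal, Literature.Probability.RandomPlanarGeometry.TendstoLaw (fun δ (ω : Ω δ) => ((⟨Literature.Probability.RandomPlanarGeometry.drivingFunction (φ) (Literature.Probability.RandomPlanarGeometry.CurveClass.mk (X δ ω)), Literature.Probability.RandomPlanarGeometry.continuous_drivingFunction (φ) (Literature.Probability.RandomPlanarGeometry.CurveClass.mk (X δ ω))⟩ : C(NNReal, ℝ)).restrict (Set.Icc (0:NNReal) T))) P (fun ω : NNReal → ℝ => ((⟨Literature.Probability.RandomPlanarGeometry.sleDriving ((8:NNReal)/3) ω, Literature.Probability.RandomPlanarGeometry.continuous_sleDriving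 ((8:NNReal)/3) ω⟩ : C(NNReal, ℝ)).restrict (Set.Icc (0:NNReal) T))) Literature.Probability.Process.preWienerMeasure) → (∀ ε : ℝ, 0 < ε → ∀ η : ℝ, 0 < η → ∃ r : ℝ, 0 < r ∧ ∀ᶠ δ in (nhdsWithin (0:ℝ) (Set.Ioi 0)), P δ {ω | ∃ s t : unitInterval, s < t ∧ dist (X δ ω s) (D.pt 1) ≤ r ∧ ε ≤ dist (X δ ω t) (D.pt 1)} ≤ ENNReal.ofReal η) → ∃ Γ : (NNReal → ℝ) → Literature.Probability.RandomPlanarGeometry.CurveClass ℂ, Literature.Probability.RandomPlanarGeometry.IsSLECurve ((8:NNReal)/3) D Γ ∧ ∀ F : Set (TopologicalSpace.NonemptyCompacts ℂ), IsClosed F → ∀ β : ENNReal, 0 < β → ∀ᶠ δ in (nhdsWithin (0:ℝ) (Set.Ioi 0)), P δ {ω | (⟨⟨(Literature.Probability.RandomPlanarGeometry.CurveClass.mk (X δ ω)).range, (Literature.Probability.RandomPlanarGeometry.CurveClass.mk (X δ ω)).isCompact_range⟩, (Literature.Probability.RandomPlanarGeometry.CurveClass.mk (X δ ω)).range_nonempty⟩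 : TopologicalSpace.NonemptyCompacts ℂ) ∈ F} ≤ Literature.Probability.Process.preWienerMeasure {ω | (⟨⟨(Γ ω).range, (Γ ω).isCompact_range⟩, (Γ ω).range_nonempty⟩ : TopologicalSpace.NonemptyCompacts ℂ) ∈ F} + β := by
  intro hLC hPK hLD D φ hφ Ω _ X P H1 H2 H3 H4 H7
  have hκ0 : (0 : ℝ≥0) < (8 : ℝ≥0) / 3 := by positivity
  haveI : IsProbabilityMeasure Process.preWienerMeasure := isProbabilityMeasure_preWienerMeasure'
  obtain ⟨Γ, hΓm, hΓae⟩ := exists_isSLECurve_through_of_ae_tendsto (D := D) (φ := φ)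
    hasSLETrace_eightThirds (tendsto_norm_sleTrace_atTop_of_ne_eight hκ0 eightThirds_ne_eight)
    JordanDomain.continuousOn_boundaryExtension_holds
    (fun t ↦ (measurable_sleTrace _ t).aemeasurable) hφ
  refine ⟨Γ, IsSLECurve.of_through hφ hΓm hΓae, fun F hF β hβ ↦ ?_⟩
  -- the range map, `1`-Lipschitz into `NonemptyCompacts ℂ` with its Borel σ-algebra
  obtain ⟨R, hR⟩ : ∃ R : CurveClass ℂ → NonemptyCompacts ℂ,
      ∀ c, R c = ⟨⟨c.range, c.isCompact_range⟩, c.range_nonempty⟩ := ⟨_, fun _ ↦ rfl⟩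
  letI : MeasurableSpace (NonemptyCompacts ℂ) := borel _
  haveI : BorelSpace (NonemptyCompacts ℂ) := ⟨rfl⟩
  have hRc : Continuous R := by
    refine (LipschitzWith.mk_one fun c c' ↦ ?_).continuous
    rw [hR, hR, Metric.NonemptyCompacts.dist_eq]
    exact CurveClass.hausdorffDist_range_le_dist c c'
  have hRΓ : AEMeasurable (fun ω ↦ R (Γ ω)) Process.preWienerMeasure :=
    hRc.measurable.comp_aemeasurable hΓm
  -- the budget `β / 5`
  have hβ'0 : β / 5 ≠ 0 := by
    rw [Ne, ENNReal.div_eq_zero_iff, not_or]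
    exact ⟨hβ.ne', ENNReal.ofNat_ne_top⟩
  have hβ'pos : 0 < β / 5 := pos_iff_ne_zero.2 hβ'0
  -- `ε` from the continuity of `r ↦ P' {range Γ ∈ F_r}` at `0`
  obtain ⟨ε, hε, hEε⟩ := exists_measure_cthickening_le hRΓ hF hβ'0
  -- the SLE tail, `η` and `r` (H7), the capacity threshold `T₀`, the horizon `T`
  obtain ⟨N₁, hN₁⟩ := exists_measure_tail_le φ (hPK D φ hφ).2 hε hβ'0
  obtain ⟨η, hη, hηβ⟩ : ∃ η : ℝ, 0 < η ∧ ENNReal.ofReal η ≤ β / 5 := by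
    rcases eq_or_ne (β / 5) ⊤ with h | h
    · exact ⟨1, one_pos, h ▸ le_top⟩
    · exact ⟨(β / 5).toReal, ENNReal.toReal_pos hβ'0 h, ENNReal.ofReal_toReal_le⟩
  obtain ⟨r, hr, hH7⟩ := H7 ε hε η hη
  obtain ⟨T₀, hT₀⟩ := (hLD D φ hφ).2 (min r ε) (lt_min hr hε)
  obtain ⟨T, hT0, hTN, hTT₀⟩ : ∃ T : ℝ≥0, 0 < T ∧ (N₁ : ℝ≥0) ≤ T ∧ T₀ ≤ T :=
    ⟨max (max (N₁ : ℝ≥0) T₀) 1, one_pos.trans_le (le_max_right _ _),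
      (le_max_left _ _).trans (le_max_left _ _), (le_max_right _ _).trans (le_max_left _ _)⟩
  have hA := (hPK D φ hφ).1 T hT0
  -- the restricted driving paths on `[0, T]`
  letI mS : MeasurableSpace C(↥(Set.Icc (0:ℝ≥0) T), ℝ) := borel _
  haveI : BorelSpace C(↥(Set.Icc (0:ℝ≥0) T), ℝ) := ⟨rfl⟩
  obtain ⟨Y, hY⟩ : ∃ Y : (δ : ℝ) → Ω δ → C(↥(Set.Icc (0:ℝ≥0) T), ℝ), Y = fun δ ω ↦
      ((⟨drivingFunction φ (CurveClass.mk (X δ ω)),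
        continuous_drivingFunction φ (CurveClass.mk (X δ ω))⟩ : C(ℝ≥0, ℝ)).restrict
        (Set.Icc (0:ℝ≥0) T)) := ⟨_, rfl⟩
  obtain ⟨Z, hZ⟩ : ∃ Z : (ℝ≥0 → ℝ) → C(↥(Set.Icc (0:ℝ≥0) T), ℝ), Z = fun ω ↦
      ((⟨sleDriving ((8:ℝ≥0)/3) ω, continuous_sleDriving ((8:ℝ≥0)/3) ω⟩ : C(ℝ≥0, ℝ)).restrict
        (Set.Icc (0:ℝ≥0) T)) := ⟨_, rfl⟩
  have hYap : ∀ δ ω, Y δ ω = ((⟨drivingFunction φ (CurveClass.mk (X δ ω)),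
      continuous_drivingFunction φ (CurveClass.mk (X δ ω))⟩ : C(ℝ≥0, ℝ)).restrict
        (Set.Icc (0:ℝ≥0) T)) := fun δ ω ↦ by rw [hY]
  have hZap : ∀ ω, Z ω = ((⟨sleDriving ((8:ℝ≥0)/3) ω, continuous_sleDriving ((8:ℝ≥0)/3) ω⟩ :
      C(ℝ≥0, ℝ)).restrict (Set.Icc (0:ℝ≥0) T)) := fun ω ↦ by rw [hZ]
  have hYm : ∀ᶠ δ in 𝓝[>] (0:ℝ), AEMeasurable (Y δ) (P δ) := by
    filter_upwards [H2] with δ hδ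
    rw [hY]
    exact ((ContinuousMap.continuous_restrict _).measurable.comp
      (measurable_drivingPathOf hφ)).comp_aemeasurable hδ
  have hZm : AEMeasurable Z Process.preWienerMeasure := by
    rw [hZ]
    exact ((ContinuousMap.continuous_restrict _).measurable.comp
      (measurable_drivingPath _)).aemeasurable
  have h4T : TendstoLaw Y P Z Process.preWienerMeasure := by
    rw [hY, hZ]
    exact H4 T
  have hLCT := (hLC C(↥(Set.Icc (0:ℝ≥0) T), ℝ) Ω (ℝ≥0 → ℝ) Y P Z Process.preWienerMeasure
    inferInstance H1 hYm hZm).1 h4T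
  -- the bad driver set `A₀`
  obtain ⟨A₀, hA₀⟩ : ∃ A₀ : Set C(↥(Set.Icc (0:ℝ≥0) T), ℝ), ∀ w, w ∈ A₀ ↔
      ∃ (W' : ℝ≥0 → ℝ) (hW' : Continuous W'),
        (⟨W', hW'⟩ : C(ℝ≥0, ℝ)).restrict (Set.Icc (0:ℝ≥0) T) = w ∧ (Loewner.hull W' T).Nonempty ∧
        ∃ K ∈ F, hausdorffDist (φ.boundaryExtension '' closure (Loewner.hull W' T)) (K : Set ℂ) ≤
          2 * ε :=
    ⟨{w | ∃ (W' : ℝ≥0 → ℝ) (hW' : Continuous W'),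
        (⟨W', hW'⟩ : C(ℝ≥0, ℝ)).restrict (Set.Icc (0:ℝ≥0) T) = w ∧ (Loewner.hull W' T).Nonempty ∧
        ∃ K ∈ F, hausdorffDist (φ.boundaryExtension '' closure (Loewner.hull W' T)) (K : Set ℂ) ≤
          2 * ε}, fun _ ↦ Iff.rfl⟩
  have hE1 := hLCT (closure A₀) isClosed_closure (β / 5) hβ'pos
  have hE2 := hLCT {0} isClosed_singleton (β / 5) hβ'pos
  -- SLE side: `{Z ∈ closure A₀} ⊆ tail-bad ∪ {range Γ ∈ F_{5ε}}` almost surely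
  have hSLE1 : Process.preWienerMeasure (Z ⁻¹' closure A₀) ≤
      β / 5 + (Process.preWienerMeasure {ω | R (Γ ω) ∈ F} + β / 5) := by
    have hsub : ∀ᵐ ω ∂Process.preWienerMeasure, ω ∈ Z ⁻¹' closure A₀ →
        ω ∈ {ω : ℝ≥0 → ℝ | ∃ t : ℝ≥0, (N₁ : ℝ≥0) ≤ t ∧
            ε < dist (φ.boundaryExtension (sleTrace ((8:ℝ≥0)/3) ω t)) (D.pt 1)} ∪
          {ω | R (Γ ω) ∈ cthickening (5 * ε) F} := by
      filter_upwards [hA, hΓae] with ω hAω hΓω hZω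
      rw [mem_union, or_iff_not_imp_left]
      intro hnt
      obtain ⟨hhull, hcont⟩ := hAω
      obtain ⟨-, c, hc, hcI⟩ := hΓω
      obtain ⟨ρ, hρ, hρc⟩ := hcont ε hε
      have htail : ∀ t : ℝ≥0, T ≤ t →
          dist (φ.boundaryExtension (sleTrace ((8:ℝ≥0)/3) ω t)) (D.pt 1) ≤ ε :=
        fun t ht ↦ not_lt.1 fun h ↦ hnt ⟨t, hTN.trans ht, h⟩
      rw [mem_preimage, hZap] at hZω
      show R (Γ ω) ∈ cthickening (5 * ε) F
      rw [hc, hR]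
      exact mem_cthickening_of_mem_closure φ (continuous_sleDriving _ ω) (continuous_sleTrace _ ω)
        (fun t ↦ Loewner.trace_im_nonneg _ t) hhull hε.le hρ hρc hcI htail
        (fun w hw ↦ (hA₀ w).1 hw) hZω
    calc Process.preWienerMeasure (Z ⁻¹' closure A₀)
        ≤ Process.preWienerMeasure ({ω : ℝ≥0 → ℝ | ∃ t : ℝ≥0, (N₁ : ℝ≥0) ≤ t ∧
            ε < dist (φ.boundaryExtension (sleTrace ((8:ℝ≥0)/3) ω t)) (D.pt 1)} ∪
          {ω | R (Γ ω) ∈ cthickening (5 * ε) F}) := measure_mono_ae hsub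
      _ ≤ Process.preWienerMeasure {ω : ℝ≥0 → ℝ | ∃ t : ℝ≥0, (N₁ : ℝ≥0) ≤ t ∧
            ε < dist (φ.boundaryExtension (sleTrace ((8:ℝ≥0)/3) ω t)) (D.pt 1)} +
          Process.preWienerMeasure {ω | R (Γ ω) ∈ cthickening (5 * ε) F} := measure_union_le _ _
      _ ≤ β / 5 + (Process.preWienerMeasure {ω | R (Γ ω) ∈ F} + β / 5) := add_le_add hN₁ hEε
  -- SLE side: the junk driver `0` is not charged (`B_T` has no atom)
  have hSLE2 : Process.preWienerMeasure (Z ⁻¹' {0}) = 0 := by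
    refine measure_mono_null (fun ω hω ↦ ?_) (measure_sleDriving_apply_eq_zero _ hκ0 hT0.ne')
    rw [mem_preimage, mem_singleton_iff, hZap] at hω
    have h := congrArg (fun w : C(↥(Set.Icc (0:ℝ≥0) T), ℝ) ↦ w ⟨T, ⟨zero_le, le_rfl⟩⟩) hω
    simpa using h
  -- lattice side, along the eventual sets of H3, H7 and the two portmanteau bounds
  have h7' : ∀ᶠ δ in 𝓝[>] (0:ℝ), P δ {ω | ∃ s t : I, s < t ∧ dist (X δ ω s) (D.pt 1) ≤ min r ε ∧
      ε ≤ dist (X δ ω t) (D.pt 1)} ≤ β / 5 := by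
    filter_upwards [hH7] with δ hδ
    refine (measure_mono ?_).trans (hδ.trans hηβ)
    rintro ω ⟨s, t, hst, hs, ht⟩
    exact ⟨s, t, hst, hs.trans (min_le_left _ _), ht⟩
  have key : ∀ᶠ δ in 𝓝[>] (0:ℝ), P δ {ω | R (CurveClass.mk (X δ ω)) ∈ F} ≤
      Process.preWienerMeasure {ω | R (Γ ω) ∈ F} + β := by
    filter_upwards [H3, h7', hE1, hE2] with δ h3 h7 e1 e2
    have hincl : {ω | R (CurveClass.mk (X δ ω)) ∈ F} ⊆ Y δ ⁻¹' closure A₀ ∪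
        {ω | ∃ s t : I, s < t ∧ dist (X δ ω s) (D.pt 1) ≤ min r ε ∧ ε ≤ dist (X δ ω t) (D.pt 1)} ∪
        Y δ ⁻¹' {0} := by
      intro ω hω
      by_cases hdesc : IsLoewnerDescribable φ (CurveClass.mk (X δ ω))
      · refine Or.inl ?_
        rw [mem_union, or_iff_not_imp_right]
        intro htl
        refine subset_closure ((hA₀ _).2 ?_)
        obtain ⟨hne, hd⟩ := lattice_hausdorffDist_le (hLD D φ hφ).1 (min_le_right r ε) hTT₀ hT0
          hT₀ (h3 ω) hdesc htl
        refine ⟨drivingFunction φ (CurveClass.mk (X δ ω)), continuous_drivingFunction φ _,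
          (hYap δ ω).symm, hne, R (CurveClass.mk (X δ ω)), hω, ?_⟩
        rw [hR]
        show hausdorffDist _ (CurveClass.mk (X δ ω)).range ≤ 2 * ε
        rw [CurveClass.range_mk]
        exact hd
      · refine Or.inr ?_
        rw [mem_preimage, mem_singleton_iff, hYap]
        ext x
        rw [ContinuousMap.restrict_apply, ContinuousMap.coe_mk, drivingFunction_of_not hdesc]
        rfl
    calc P δ {ω | R (CurveClass.mk (X δ ω)) ∈ F}
        ≤ P δ (Y δ ⁻¹' closure A₀ ∪ {ω | ∃ s t : I, s < t ∧ dist (X δ ω s) (D.pt 1) ≤ min r ε ∧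
            ε ≤ dist (X δ ω t) (D.pt 1)} ∪ Y δ ⁻¹' {0}) := measure_mono hincl
      _ ≤ P δ (Y δ ⁻¹' closure A₀) + P δ {ω | ∃ s t : I, s < t ∧
            dist (X δ ω s) (D.pt 1) ≤ min r ε ∧ ε ≤ dist (X δ ω t) (D.pt 1)} + P δ (Y δ ⁻¹' {0}) :=
          (measure_union_le _ _).trans (add_le_add (measure_union_le _ _) le_rfl)
      _ ≤ (Process.preWienerMeasure (Z ⁻¹' closure A₀) + β / 5) + β / 5 +
            (Process.preWienerMeasure (Z ⁻¹' {0}) + β / 5) := add_le_add (add_le_add e1 h7) e2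
      _ ≤ (β / 5 + (Process.preWienerMeasure {ω | R (Γ ω) ∈ F} + β / 5) + β / 5) + β / 5 +
            (0 + β / 5) :=
          add_le_add (add_le_add (add_le_add hSLE1 le_rfl) le_rfl) (add_le_add hSLE2.le le_rfl)
      _ = Process.preWienerMeasure {ω | R (Γ ω) ∈ F} + 5 * (β / 5) := by ring
      _ ≤ Process.preWienerMeasure {ω | R (Γ ω) ∈ F} + β :=
          add_le_add le_rfl ENNReal.mul_div_le
  simpa only [hR] using key

end PathUpgradeRRangeBound

/-- **`RangeBound`** (crux `PathUpgradeR`, line `bidir_windows`; registered stub `stub_rangeBound`): for random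
SIMPLE curves `X δ ω` from `a` to `b` in a Dobrushin domain with H1 (eventually probability), H2 (eventually
a.e.-measurable classes), H3 (simple, endpoints, interior), H4 (forward driving functions converge in law on
every `[0, T]` to `√(8/3) B`) and H7 (no escape from `b`), there is an SLE_(8/3) curve `Γ` of `D` with
`∀ F closed ⊆ NonemptyCompacts ℂ, ∀ β > 0, ∀ᶠ δ, P δ {range X ∈ F} ≤ P' {range Γ ∈ F} + β`. It is
`PathUpgradeRRangeBound.rangeBound_of` fed with the three LANDED neighbour statements of the line
(`stub_lawClosed`, `stub_sleHullPackage stub_hullHausdorff`, `stub_latticeDictionary`). [folklore] -/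
theorem stub_rangeBound : ∀ (D : Literature.Probability.RandomPlanarGeometry.DobrushinDomain) (φ : Literature.Probability.RandomPlanarGeometry.ConformalEquiv UpperHalfPlane.upperHalfPlaneSet D.carrier), D.IsChordalUniformizing φ → ∀ (Ω : ℝ → Type) [∀ δ, MeasurableSpace (Ω δ)] (X : (δ : ℝ) → Ω δ → Literature.Probability.RandomPlanarGeometry.Curve ℂ) (P : (δ : ℝ) → MeasureTheory.Measure (Ω δ)), (∀ᶠ δ in (nhdsWithin (0:ℝ) (Set.Ioi 0)), MeasureTheory.IsProbabilityMeasure (P δ)) → (∀ᶠ δ in (nhdsWithin (0:ℝ) (Set.Ioi 0)), AEMeasurable (fun ω => Literature.Probability.RandomPlanarGeometry.CurveClass.mk (X δ ω)) (P δ)) → (∀ᶠ δ in (nhdsWithin (0:ℝ) (Set.Ioi 0)), ∀ ω : Ω δ, Function.Injective (X δ ω) ∧ (X δ ω).source = D.pt 0 ∧ (X δ ω).target = D.pt 1 ∧ ∀ t : unitInterval, X δ ω t = D.pt 0 ∨ X δ ω t = D.pt 1 ∨ X δ ω t ∈ D.carrier) → (∀ T : NNReal, Literature.Probability.RandomPlanarGeometry.TendstoLaw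 (fun δ (ω : Ω δ) => ((⟨Literature.Probability.RandomPlanarGeometry.drivingFunction (φ) (Literature.Probability.RandomPlanarGeometry.CurveClass.mk (X δ ω)), Literature.Probability.RandomPlanarGeometry.continuous_drivingFunction (φ) (Literature.Probability.RandomPlanarGeometry.CurveClass.mk (X δ ω))⟩ : C(NNReal, ℝ)).restrict (Set.Icc (0:NNReal) T))) P (fun ω : NNReal → ℝ => ((⟨Literature.Probability.RandomPlanarGeometry.sleDriving ((8:NNReal)/3) ω, Literature.Probability.RandomPlanarGeometry.continuous_sleDriving ((8:NNReal)/3) ω⟩ : C(NNReal, ℝ)).restrict (Set.Icc (0:NNReal) T))) Literature.Probability.Process.preWienerMeasure) → (∀ ε : ℝ, 0 < ε → ∀ η : ℝ, 0 < η → ∃ r : ℝ, 0 < r ∧ ∀ᶠ δ in (nhdsWithin (0:ℝ) (Set.Ioi 0)), P δ {ω | ∃ s t : unitInterval, s < t ∧ dist (X δ ω s) (D.pt 1) ≤ r ∧ ε ≤ dist (X δ ω t) (D.pt 1)} ≤ ENNReal.ofReal η) → ∃ Γ : (NNReal → ℝ) → Literature.Probability.RandomPlanarGeometry.CurveClass ℂ,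 Literature.Probability.RandomPlanarGeometry.IsSLECurve ((8:NNReal)/3) D Γ ∧ ∀ F : Set (TopologicalSpace.NonemptyCompacts ℂ), IsClosed F → ∀ β : ENNReal, 0 < β → ∀ᶠ δ in (nhdsWithin (0:ℝ) (Set.Ioi 0)), P δ {ω | (⟨⟨(Literature.Probability.RandomPlanarGeometry.CurveClass.mk (X δ ω)).range, (Literature.Probability.RandomPlanarGeometry.CurveClass.mk (X δ ω)).isCompact_range⟩, (Literature.Probability.RandomPlanarGeometry.CurveClass.mk (X δ ω)).range_nonempty⟩ : TopologicalSpace.NonemptyCompacts ℂ) ∈ F} ≤ Literature.Probability.Process.preWienerMeasure {ω | (⟨⟨(Γ ω).range, (Γ ω).isCompact_range⟩, (Γ ω).range_nonempty⟩ : TopologicalSpace.NonemptyCompacts ℂ) ∈ F} + β :=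
  PathUpgradeRRangeBound.rangeBound_of stub_lawClosed (stub_sleHullPackage stub_hullHausdorff)
    stub_latticeDictionary

end Summit.CriticalPhenomena.SAWScalingLimit.Theorems

end
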